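import Mathlib
import Literature.NumberTheory.Transcendental.AssociatorsLieProofs
import HarnessLib

/-!
# Associators VI: the free subalgebra of chords through one strand [BarnatanDancso2011, §4]

Fifth proofs file towards [Furusho2010, Thm 1]. The combinatorial heart of the Lie-algebra version
([Furusho2010, Thm 3] = [BarnatanDancso2011, Main Lemma 3.2]) uses that the chords touching a
fixed strand generate a **free** subalgebra: "⟨t₁₂, t₂₃, t₂₄⟩ ≅ 𝔉₃ ⊆ 𝒜₄, since there are no
relations in 𝒜₄ that involve only these elements" [BarnatanDancso2011, §4] (in [Furusho2010, §1]:
"X₂₁, X₂₃, X₂₄, X₂₅ generate a completed Lie subalgebra 𝔉₃ of 𝔓₅ which is free of rank 3"). We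
prove the form of this statement that the proof needs — a retraction onto the truncated free
algebra — through the classical representation of `U𝔞₄` on `k⟨x₀, x₂, x₃⟩` in which the chords
`t₁ⱼ` through the distinguished strand `1` act by left multiplication by `xⱼ` and the other chords
`tᵢⱼ` act by the derivation `xᵢ ↦ [xᵢ, xⱼ], xⱼ ↦ [xⱼ, xᵢ], xₗ ↦ 0` (the semidirect structure
`𝔞₄ = 𝔣₃ ⋊ 𝔞₃`):

1. the weight filtration `NCSeries.Fil n` of the truncated free algebra
   `V = NCSeries α k ⧸ truncIdeal α k N` and its multiplicativity;
2. **derivations of `V` from their values on letters** (`NCSeries.sderiv`), built with the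
   evaluation morphism into the trivial square-zero extension `V ⋉ V` (Leibniz rule
   `NCSeries.sderiv_mul`), and the uniqueness principle `NCSeries.IsDer.eq_zero_of_letters`;
3. the representation `NCSeries.rep : U𝔞₄ ⊗ k/(deg > N) → End_k(V)` on three letters
   (`NCSeries.repF_compatible`) and the **retraction formula** `NCSeries.rep_evalTrunc_one`:
   `rep(ψ(a, b))(1) = ψ(ā, b̄)` for `a, b` in the span of `t₁₀, t₁₂, t₁₃`, where `ā, b̄` are the
   corresponding elements of the span of the letters.

No named facts are introduced.

## References

* D. Bar-Natan, Z. Dancso, *Pentagon and hexagon equations following Furusho*, Proc. AMS 140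
  (2012), 1243–1250, §4 (proof of the Main Lemma). [BarnatanDancso2011]
* H. Furusho, *Pentagon and hexagon equations*, Ann. of Math. 171 (2010), §1, proof of Thm 3.
  [Furusho2010]
-/

noncomputable section

open scoped BigOperators

namespace Literature.NumberTheory.Transcendental

universe u v

namespace NCSeries

/-! ## 1. The weight filtration of the truncated free algebra -/

section Filtration

variable {α : Type u} {k : Type v} [CommRing k]

variable (α k) in
/-- Series vanishing below weight `n`, as a `k`-submodule of `k⟨⟨α⟩⟩`. [folklore] -/
def lowVanish (n : ℕ) : Submodule k (NCSeries α k) where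
  carrier := {φ | ∀ w : List α, w.length < n → φ w = 0}
  add_mem' {φ ψ} hφ hψ w hw := by simp [hφ w hw, hψ w hw]
  zero_mem' _ _ := rfl
  smul_mem' c φ hφ w hw := by simp [hφ w hw]

/-- Membership in `lowVanish`. [folklore] -/
theorem mem_lowVanish {n : ℕ} {φ : NCSeries α k} :
    φ ∈ lowVanish α k n ↔ ∀ w : List α, w.length < n → φ w = 0 := Iff.rfl

/-- Weights add under multiplication. [folklore] -/
theorem mul_mem_lowVanish {a b : ℕ} {φ ψ : NCSeries α k} (hφ : φ ∈ lowVanish α k a)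
    (hψ : ψ ∈ lowVanish α k b) : φ * ψ ∈ lowVanish α k (a + b) := by
  intro w hw
  rw [mul_apply]
  refine Finset.sum_eq_zero ?_
  rintro ⟨u, u'⟩ hp
  rw [mem_splits] at hp
  dsimp only
  have hl : u.length + u'.length = w.length := by rw [← hp, List.length_append]
  by_cases hu : u.length < a
  · rw [hφ u hu, zero_mul]
  · rw [hψ u' (by omega), mul_zero]

/-- Everything vanishes below weight `0`. [folklore] -/
theorem lowVanish_zero : lowVanish α k 0 = ⊤ := by
  ext φ; simp [mem_lowVanish]

/-- `lowVanish` is antitone. [folklore] -/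
theorem lowVanish_antitone {m n : ℕ} (h : m ≤ n) : lowVanish α k n ≤ lowVanish α k m :=
  fun _ hφ w hw => hφ w (by omega)

/-- Letters have weight `1`. [folklore] -/
theorem letter_mem_lowVanish [DecidableEq α] (a : α) : (letter a : NCSeries α k) ∈ lowVanish α k 1 := by
  intro w hw
  rw [Nat.lt_one_iff, List.length_eq_zero_iff] at hw
  subst hw
  simp

variable (N : ℕ)

variable (α k) in
/-- **The weight filtration of the truncated free algebra** `V = k⟨⟨α⟩⟩/(deg > N)`:
`Fil n` = classes of series vanishing below weight `n`. [folklore] -/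
def Fil (n : ℕ) : Submodule k (NCSeries α k ⧸ truncIdeal α k N) :=
  (lowVanish α k n).map (Ideal.Quotient.mkₐ k (truncIdeal α k N)).toLinearMap

/-- Classes of low-vanishing series lie in the filtration. [folklore] -/
theorem mk_mem_Fil {n : ℕ} {φ : NCSeries α k} (hφ : φ ∈ lowVanish α k n) :
    Ideal.Quotient.mk (truncIdeal α k N) φ ∈ Fil α k N n :=
  Submodule.mem_map_of_mem hφ

/-- The filtration is multiplicative. [folklore] -/
theorem mul_mem_Fil {a b : ℕ} {x y : NCSeries α k ⧸ truncIdeal α k N} (hx : x ∈ Fil α k N a)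
    (hy : y ∈ Fil α k N b) : x * y ∈ Fil α k N (a + b) := by
  obtain ⟨φ, hφ, rfl⟩ := Submodule.mem_map.mp hx
  obtain ⟨ψ, hψ, rfl⟩ := Submodule.mem_map.mp hy
  change Ideal.Quotient.mk _ φ * Ideal.Quotient.mk _ ψ ∈ _
  rw [← map_mul]
  exact mk_mem_Fil N (mul_mem_lowVanish hφ hψ)

/-- The filtration is exhaustive: `Fil 0 = ⊤`. [folklore] -/
theorem Fil_zero : Fil α k N 0 = ⊤ := by
  rw [Fil, lowVanish_zero, Submodule.map_top, LinearMap.range_eq_top]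
  exact Ideal.Quotient.mk_surjective

/-- The filtration is antitone. [folklore] -/
theorem Fil_antitone {m n : ℕ} (h : m ≤ n) : Fil α k N n ≤ Fil α k N m :=
  Submodule.map_mono (lowVanish_antitone h)

/-- The filtration dies at weight `N + 1`. [folklore] -/
theorem Fil_succ_eq_bot : Fil α k N (N + 1) = ⊥ := by
  rw [eq_bot_iff]
  rintro x hx
  obtain ⟨φ, hφ, rfl⟩ := Submodule.mem_map.mp hx
  rw [Submodule.mem_bot]
  change Ideal.Quotient.mk _ φ = 0
  rw [Ideal.Quotient.eq_zero_iff_mem, mem_truncIdeal]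
  exact fun w hw => hφ w (by omega)

/-- Above weight `N` the filtration vanishes. [folklore] -/
theorem eq_zero_of_mem_Fil {n : ℕ} (hn : N < n) {x : NCSeries α k ⧸ truncIdeal α k N}
    (hx : x ∈ Fil α k N n) : x = 0 := by
  have h := Fil_antitone N (show N + 1 ≤ n by omega) hx
  rwa [Fil_succ_eq_bot, Submodule.mem_bot] at h

/-- Letters lie in `Fil 1`. [folklore] -/
theorem mk_letter_mem_Fil [DecidableEq α] (a : α) :
    Ideal.Quotient.mk (truncIdeal α k N) (letter a) ∈ Fil α k N 1 :=
  mk_mem_Fil N (letter_mem_lowVanish a)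

/-- **Every class is a finite combination of monomial classes** of weight `≤ N`. [folklore] -/
theorem mk_eq_sum_monomial [Fintype α] [DecidableEq α] (φ : NCSeries α k) :
    Ideal.Quotient.mk (truncIdeal α k N) φ =
      ∑ w ∈ wordsLE α N, φ w • Ideal.Quotient.mk (truncIdeal α k N) (monomial w 1) := by
  have h : ∑ w ∈ wordsLE α N, φ w • Ideal.Quotient.mk (truncIdeal α k N) (monomial w 1) =
      Ideal.Quotient.mk (truncIdeal α k N) (∑ w ∈ wordsLE α N, φ w • monomial w 1) := by
    rw [map_sum]
    refine Finset.sum_congr rfl fun w _ => ?_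
    rw [← Ideal.Quotient.mkₐ_eq_mk k, map_smul]
  rw [h, mk_eq_mk_iff]
  intro u hu
  rw [finset_sum_apply]
  simp_rw [smul_apply, monomial_apply, smul_eq_mul, mul_ite, mul_one, mul_zero]
  rw [Finset.sum_ite_eq (wordsLE α N) u (fun w => φ w), if_pos (mem_wordsLE.mpr hu)]

/-- Monomials are products of letters: `cons`. [folklore] -/
theorem monomial_cons [DecidableEq α] (a : α) (w : List α) :
    (monomial (a :: w) 1 : NCSeries α k) = letter a * monomial w 1 := by
  change _ = monomial [a] 1 * monomial w 1
  rw [monomial_mul_monomial, one_mul]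
  rfl

end Filtration

/-! ## 2. Operators raising the weight; derivations from their values on letters -/

section Operators

variable {α : Type u} {k : Type v} [CommRing k] (N : ℕ)

/-- An endomorphism **raises the weight** if it maps `Fil n` into `Fil (n+1)`. [folklore] -/
def Raises (T : Module.End k (NCSeries α k ⧸ truncIdeal α k N)) : Prop :=
  ∀ (n : ℕ) (x : NCSeries α k ⧸ truncIdeal α k N), x ∈ Fil α k N n → T x ∈ Fil α k N (n + 1)

/-- A product of more than `N` weight-raising operators vanishes. [folklore] -/
theorem list_prod_eq_zero_of_raises (L : List (Module.End k (NCSeries α k ⧸ truncIdeal α k N)))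
    (hL : ∀ T ∈ L, Raises N T) (hlen : N < L.length) : L.prod = 0 := by
  have key : ∀ (L : List (Module.End k (NCSeries α k ⧸ truncIdeal α k N))),
      (∀ T ∈ L, Raises N T) → ∀ (n : ℕ) (x : NCSeries α k ⧸ truncIdeal α k N),
        x ∈ Fil α k N n → L.prod x ∈ Fil α k N (n + L.length) := by
    intro L
    induction L with
    | nil => intro _ n x hx; simpa using hx
    | cons T L ih =>
      intro h n x hx
      rw [List.prod_cons, Module.End.mul_apply, List.length_cons, ← add_assoc]
      have h1 := ih (fun S hS => h S (List.mem_cons_of_mem _ hS)) n x hx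
      have h2 := h T List.mem_cons_self (n + L.length) _ h1
      exact h2
  apply LinearMap.ext
  intro x
  rw [LinearMap.zero_apply]
  have hx : x ∈ Fil α k N 0 := by rw [Fil_zero]; exact Submodule.mem_top
  exact eq_zero_of_mem_Fil N (by omega) (key L hL 0 x hx)

/-- Left multiplication by an element of `Fil 1` raises the weight. [folklore] -/
theorem raises_mulLeft {y : NCSeries α k ⧸ truncIdeal α k N} (hy : y ∈ Fil α k N 1) :
    Raises N (LinearMap.mulLeft k y) := by
  intro n x hx
  rw [LinearMap.mulLeft_apply, add_comm]
  exact mul_mem_Fil N hy hx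

/-- A **derivation-like operator** of the truncated free algebra: kills `1`, Leibniz rule.
[folklore] -/
structure IsDer (T : Module.End k (NCSeries α k ⧸ truncIdeal α k N)) : Prop where
  /-- `T 1 = 0` -/
  map_one : T 1 = 0
  /-- the Leibniz rule -/
  leibniz : ∀ x y, T (x * y) = T x * y + x * T y

/-- Sums of derivations are derivations. [folklore] -/
theorem IsDer.add {S T : Module.End k (NCSeries α k ⧸ truncIdeal α k N)} (hS : IsDer N S)
    (hT : IsDer N T) : IsDer N (S + T) :=
  ⟨by simp [hS.map_one, hT.map_one], fun x y => by
    simp only [LinearMap.add_apply, hS.leibniz, hT.leibniz]; noncomm_ring⟩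

/-- Commutators of derivations are derivations. [folklore] -/
theorem IsDer.commutator {S T : Module.End k (NCSeries α k ⧸ truncIdeal α k N)} (hS : IsDer N S)
    (hT : IsDer N T) : IsDer N (S * T - T * S) :=
  ⟨by simp [Module.End.mul_apply, hS.map_one, hT.map_one], fun x y => by
    simp only [LinearMap.sub_apply, Module.End.mul_apply, hS.leibniz, hT.leibniz, map_add]
    noncomm_ring⟩

/-- **A derivation vanishing on the letters vanishes** (the truncated free algebra is generated by
its letters). [folklore] -/
theorem IsDer.eq_zero_of_letters [Fintype α] [DecidableEq α]
    {T : Module.End k (NCSeries α k ⧸ truncIdeal α k N)} (hT : IsDer N T)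
    (h : ∀ a : α, T (Ideal.Quotient.mk (truncIdeal α k N) (letter a)) = 0) : T = 0 := by
  have hmon : ∀ w : List α, T (Ideal.Quotient.mk (truncIdeal α k N) (monomial w 1)) = 0 := by
    intro w
    induction w with
    | nil => rw [monomial_nil_one, (Ideal.Quotient.mk (truncIdeal α k N)).map_one]; exact hT.map_one
    | cons a w ih => rw [monomial_cons, map_mul, hT.leibniz, h a, ih, zero_mul, mul_zero, add_zero]
  apply LinearMap.ext
  intro x
  obtain ⟨φ, rfl⟩ := Ideal.Quotient.mk_surjective x
  rw [LinearMap.zero_apply, mk_eq_sum_monomial N φ, map_sum]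
  exact Finset.sum_eq_zero fun w _ => by rw [map_smul, hmon w, smul_zero]

/-- A derivation with values on letters in `Fil 2` raises the weight. [folklore] -/
theorem IsDer.raises [Fintype α] [DecidableEq α]
    {T : Module.End k (NCSeries α k ⧸ truncIdeal α k N)} (hT : IsDer N T)
    (h : ∀ a : α, T (Ideal.Quotient.mk (truncIdeal α k N) (letter a)) ∈ Fil α k N 2) :
    Raises N T := by
  have hmon : ∀ w : List α,
      T (Ideal.Quotient.mk (truncIdeal α k N) (monomial w 1)) ∈ Fil α k N (w.length + 1) := by
    intro w
    induction w with
    | nil =>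
      rw [monomial_nil_one, (Ideal.Quotient.mk (truncIdeal α k N)).map_one, hT.map_one]
      exact Submodule.zero_mem _
    | cons a w ih =>
      rw [monomial_cons, map_mul, hT.leibniz, List.length_cons]
      refine Submodule.add_mem _ ?_ ?_
      · have := mul_mem_Fil N (h a) (mk_mem_Fil N (n := w.length) (φ := monomial w 1)
          (fun u hu => by rw [monomial_apply, if_neg]; rintro rfl; omega))
        rw [add_comm] at this
        exact Fil_antitone N (by omega) this
      · have := mul_mem_Fil N (mk_letter_mem_Fil N a) ih
        exact Fil_antitone N (by omega) this
  intro n x hx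
  obtain ⟨φ, hφ, rfl⟩ := Submodule.mem_map.mp hx
  change T (Ideal.Quotient.mk _ φ) ∈ _
  rw [mk_eq_sum_monomial N φ, map_sum]
  refine Submodule.sum_mem _ fun w _ => ?_
  by_cases hwn : w.length < n
  · rw [hφ w hwn, zero_smul, map_zero]; exact Submodule.zero_mem _
  · rw [map_smul]
    exact Submodule.smul_mem _ _ (Fil_antitone N (by omega) (hmon w))

/-- Commutator of a derivation with a left multiplication: `[D, L_y] = L_{D y}`. [folklore] -/
theorem IsDer.mul_mulLeft_sub {T : Module.End k (NCSeries α k ⧸ truncIdeal α k N)} (hT : IsDer N T)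
    (y : NCSeries α k ⧸ truncIdeal α k N) :
    T * LinearMap.mulLeft k y - LinearMap.mulLeft k y * T = LinearMap.mulLeft k (T y) := by
  apply LinearMap.ext
  intro x
  simp only [LinearMap.sub_apply, Module.End.mul_apply, LinearMap.mulLeft_apply, hT.leibniz]
  abel

/-- Commutator of left multiplications: `[L_x, L_y] = L_{[x,y]}`. [folklore] -/
theorem mulLeft_mul_sub (x y : NCSeries α k ⧸ truncIdeal α k N) :
    LinearMap.mulLeft k x * LinearMap.mulLeft k y - LinearMap.mulLeft k y * LinearMap.mulLeft k x =
      LinearMap.mulLeft k (x * y - y * x) := by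
  apply LinearMap.ext
  intro z
  simp only [LinearMap.sub_apply, Module.End.mul_apply, LinearMap.mulLeft_apply]
  noncomm_ring

variable [Fintype α] [DecidableEq α]

/-- The second projection `V ⋉ V → V`, `k`-linearly. [folklore] -/
def sndₗ : TrivSqZeroExt (NCSeries α k ⧸ truncIdeal α k N) (NCSeries α k ⧸ truncIdeal α k N) →ₗ[k]
    (NCSeries α k ⧸ truncIdeal α k N) where
  toFun := TrivSqZeroExt.snd
  map_add' _ _ := rfl
  map_smul' _ _ := rfl

omit [Fintype α] in
/-- The substitution `a ↦ (x_a, d_a)` into `V ⋉ V` is `(N+1)`-nilpotent when the `d_a` have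
weight `≥ 2`. [folklore] -/
theorem prod_map_inl_add_inr_eq_zero (d : α → NCSeries α k ⧸ truncIdeal α k N)
    (hd : ∀ a, d a ∈ Fil α k N 2) (w : List α) (hw : N < w.length) :
    (w.map fun a => (TrivSqZeroExt.inl (Ideal.Quotient.mk (truncIdeal α k N) (letter a)) +
      TrivSqZeroExt.inr (d a) : TrivSqZeroExt (NCSeries α k ⧸ truncIdeal α k N)
        (NCSeries α k ⧸ truncIdeal α k N))).prod = 0 := by
  -- `G n z`: first component of weight ≥ n, second of weight ≥ n + 1
  have key : ∀ w : List α,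
      ((w.map fun a => (TrivSqZeroExt.inl (Ideal.Quotient.mk (truncIdeal α k N) (letter a)) +
        TrivSqZeroExt.inr (d a) : TrivSqZeroExt (NCSeries α k ⧸ truncIdeal α k N)
          (NCSeries α k ⧸ truncIdeal α k N))).prod).fst ∈ Fil α k N w.length ∧
      ((w.map fun a => (TrivSqZeroExt.inl (Ideal.Quotient.mk (truncIdeal α k N) (letter a)) +
        TrivSqZeroExt.inr (d a) : TrivSqZeroExt (NCSeries α k ⧸ truncIdeal α k N)
          (NCSeries α k ⧸ truncIdeal α k N))).prod).snd ∈ Fil α k N (w.length + 1) := by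
    intro w
    induction w with
    | nil =>
      simp only [List.map_nil, List.prod_nil, TrivSqZeroExt.fst_one, TrivSqZeroExt.snd_one,
        List.length_nil]
      exact ⟨by rw [Fil_zero]; exact Submodule.mem_top, Submodule.zero_mem _⟩
    | cons a w ih =>
      rw [List.map_cons, List.prod_cons, List.length_cons]
      constructor
      · rw [TrivSqZeroExt.fst_mul]
        simp only [TrivSqZeroExt.fst_add, TrivSqZeroExt.fst_inl, TrivSqZeroExt.fst_inr, add_zero]
        have := mul_mem_Fil N (mk_letter_mem_Fil N a) ih.1
        rwa [add_comm] at this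
      · rw [TrivSqZeroExt.snd_mul]
        simp only [TrivSqZeroExt.fst_add, TrivSqZeroExt.fst_inl, TrivSqZeroExt.fst_inr, add_zero,
          TrivSqZeroExt.snd_add, TrivSqZeroExt.snd_inl, TrivSqZeroExt.snd_inr, zero_add,
          smul_eq_mul, MulOpposite.smul_eq_mul_unop, MulOpposite.unop_op]
        refine Submodule.add_mem _ ?_ ?_
        · have := mul_mem_Fil N (mk_letter_mem_Fil N a) ih.2
          exact Fil_antitone N (by omega) this
        · have := mul_mem_Fil N (hd a) ih.1
          exact Fil_antitone N (by omega) this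
  obtain ⟨h1, h2⟩ := key w
  ext
  · exact eq_zero_of_mem_Fil N hw h1
  · exact eq_zero_of_mem_Fil N (by omega) h2

/-- The algebra morphism `V → V ⋉ V`, `x_a ↦ (x_a, d_a)`, whose second component is the
derivation with values `d_a` on the letters. [folklore] -/
def sderivHom (d : α → NCSeries α k ⧸ truncIdeal α k N) (hd : ∀ a, d a ∈ Fil α k N 2) :
    (NCSeries α k ⧸ truncIdeal α k N) →ₐ[k]
      TrivSqZeroExt (NCSeries α k ⧸ truncIdeal α k N) (NCSeries α k ⧸ truncIdeal α k N) :=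
  evalQuotHom N (fun a => TrivSqZeroExt.inl (Ideal.Quotient.mk (truncIdeal α k N) (letter a)) +
    TrivSqZeroExt.inr (d a)) (prod_map_inl_add_inr_eq_zero N d hd)

/-- The first component of `sderivHom` is the identity. [folklore] -/
theorem fst_sderivHom (d : α → NCSeries α k ⧸ truncIdeal α k N) (hd : ∀ a, d a ∈ Fil α k N 2)
    (x : NCSeries α k ⧸ truncIdeal α k N) : (sderivHom N d hd x).fst = x := by
  obtain ⟨φ, rfl⟩ := Ideal.Quotient.mk_surjective x
  rw [sderivHom, evalQuotHom_mk]
  have h := algHom_evalTrunc (TrivSqZeroExt.fstHom k (NCSeries α k ⧸ truncIdeal α k N)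
    (NCSeries α k ⧸ truncIdeal α k N)) N (fun a => TrivSqZeroExt.inl
      (Ideal.Quotient.mk (truncIdeal α k N) (letter a)) + TrivSqZeroExt.inr (d a)) φ
  rw [TrivSqZeroExt.fstHom_apply] at h
  rw [h]
  have e : (TrivSqZeroExt.fstHom k (NCSeries α k ⧸ truncIdeal α k N)
      (NCSeries α k ⧸ truncIdeal α k N)) ∘ (fun a => TrivSqZeroExt.inl
        (Ideal.Quotient.mk (truncIdeal α k N) (letter a)) + TrivSqZeroExt.inr (d a)) =
      (Ideal.Quotient.mkₐ k (truncIdeal α k N)) ∘ (fun a => letter ((Equiv.refl α) a)) := by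
    funext a
    simp [TrivSqZeroExt.fstHom_apply, Ideal.Quotient.mkₐ_eq_mk]
  rw [e, ← algHom_evalTrunc, Ideal.Quotient.mkₐ_eq_mk, mk_eq_mk_iff]
  intro w hw
  rw [evalTrunc_letter_perm_apply, if_pos hw]
  simp

/-- **The derivation of the truncated free algebra with prescribed values on the letters.**
[folklore] -/
def sderiv (d : α → NCSeries α k ⧸ truncIdeal α k N) (hd : ∀ a, d a ∈ Fil α k N 2) :
    Module.End k (NCSeries α k ⧸ truncIdeal α k N) :=
  (sndₗ N).comp (sderivHom N d hd).toLinearMap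

/-- `sderiv d (x) = (sderivHom d x).snd`. [folklore] -/
theorem sderiv_apply (d : α → NCSeries α k ⧸ truncIdeal α k N) (hd : ∀ a, d a ∈ Fil α k N 2)
    (x : NCSeries α k ⧸ truncIdeal α k N) : sderiv N d hd x = (sderivHom N d hd x).snd := rfl

/-- **Leibniz rule.** [folklore] -/
theorem sderiv_mul (d : α → NCSeries α k ⧸ truncIdeal α k N) (hd : ∀ a, d a ∈ Fil α k N 2)
    (x y : NCSeries α k ⧸ truncIdeal α k N) :
    sderiv N d hd (x * y) = sderiv N d hd x * y + x * sderiv N d hd y := by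
  rw [sderiv_apply, sderiv_apply, sderiv_apply, map_mul, TrivSqZeroExt.snd_mul, fst_sderivHom,
    fst_sderivHom, smul_eq_mul, MulOpposite.smul_eq_mul_unop, MulOpposite.unop_op, add_comm]

/-- `sderiv d 1 = 0`. [folklore] -/
theorem sderiv_one (d : α → NCSeries α k ⧸ truncIdeal α k N) (hd : ∀ a, d a ∈ Fil α k N 2) :
    sderiv N d hd 1 = 0 := by
  rw [sderiv_apply, map_one, TrivSqZeroExt.snd_one]

/-- `sderiv d` is a derivation. [folklore] -/
theorem isDer_sderiv (d : α → NCSeries α k ⧸ truncIdeal α k N) (hd : ∀ a, d a ∈ Fil α k N 2) :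
    IsDer N (sderiv N d hd) :=
  ⟨sderiv_one N d hd, sderiv_mul N d hd⟩

/-- **Values on letters**: `sderiv d (x_a) = d_a`. [folklore] -/
theorem sderiv_letter (d : α → NCSeries α k ⧸ truncIdeal α k N) (hd : ∀ a, d a ∈ Fil α k N 2)
    (a : α) : sderiv N d hd (Ideal.Quotient.mk (truncIdeal α k N) (letter a)) = d a := by
  rw [sderiv_apply, sderivHom, evalQuotHom_mk, evalTrunc_letter N _
    (prod_map_inl_add_inr_eq_zero N d hd)]
  simp

/-- `sderiv d` raises the weight. [folklore] -/
theorem raises_sderiv (d : α → NCSeries α k ⧸ truncIdeal α k N) (hd : ∀ a, d a ∈ Fil α k N 2) :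
    Raises N (sderiv N d hd) :=
  (isDer_sderiv N d hd).raises N fun a => by rw [sderiv_letter]; exact hd a

end Operators

/-! ## 3. The representation of `U𝔞₄` on three letters and the retraction -/

section Rep

variable {k : Type u} [CommRing k] (N : ℕ)

/-- The letter classes `x_c`, `c : Fin 3`, of `V = k⟨⟨x₀,x₁,x₂⟩⟩/(deg > N)`. [folklore] -/
abbrev xg (c : Fin 3) : NCSeries (Fin 3) k ⧸ truncIdeal (Fin 3) k N :=
  Ideal.Quotient.mk (truncIdeal (Fin 3) k N) (letter c)

/-- The values on letters of the derivation attached to the chord `{a, b}`: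
`x_a ↦ [x_a, x_b]`, `x_b ↦ [x_b, x_a]`, `x_c ↦ 0`. [cite: BarnatanDancso2011, §4] -/
def drule (a b : Fin 3) (c : Fin 3) : NCSeries (Fin 3) k ⧸ truncIdeal (Fin 3) k N :=
  if c = a then xg N a * xg N b - xg N b * xg N a
  else if c = b then xg N b * xg N a - xg N a * xg N b else 0

/-- The rule is symmetric in the chord. [folklore] -/
theorem drule_comm (a b : Fin 3) : drule (k := k) N a b = drule N b a := by
  funext c
  unfold drule
  by_cases hca : c = a
  · subst hca
    by_cases hcb : c = b
    · subst hcb; simp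
    · rw [if_pos rfl, if_neg hcb, if_pos rfl]
  · rw [if_neg hca]
    by_cases hcb : c = b
    · subst hcb; rw [if_pos rfl, if_pos rfl]
    · rw [if_neg hcb, if_neg hcb, if_neg hca]

/-- The rule has weight-`2` values. [folklore] -/
theorem drule_mem_Fil (a b c : Fin 3) : drule (k := k) N a b c ∈ Fil (Fin 3) k N 2 := by
  unfold drule
  have h2 : ∀ i j : Fin 3, xg (k := k) N i * xg N j ∈ Fil (Fin 3) k N 2 := fun i j =>
    mul_mem_Fil N (mk_letter_mem_Fil N i) (mk_letter_mem_Fil N j)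
  split_ifs
  · exact Submodule.sub_mem _ (h2 _ _) (h2 _ _)
  · exact Submodule.sub_mem _ (h2 _ _) (h2 _ _)
  · exact Submodule.zero_mem _

/-- The derivation `D_{ab}` of the chord `{a, b}` (strands `≠ 1`). [cite: BarnatanDancso2011, §4] -/
def Dop (a b : Fin 3) : Module.End k (NCSeries (Fin 3) k ⧸ truncIdeal (Fin 3) k N) :=
  sderiv N (drule N a b) (drule_mem_Fil N a b)

/-- `D_{ab} = D_{ba}`. [folklore] -/
theorem Dop_comm (a b : Fin 3) : Dop (k := k) N a b = Dop N b a := by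
  unfold Dop
  congr 1
  · exact drule_comm N a b

/-- `D_{ab}` is a derivation. [folklore] -/
theorem isDer_Dop (a b : Fin 3) : IsDer N (Dop (k := k) N a b) := isDer_sderiv N _ _

/-- `D_{ab}` raises the weight. [folklore] -/
theorem raises_Dop (a b : Fin 3) : Raises N (Dop (k := k) N a b) := raises_sderiv N _ _

/-- `D_{ab}(x_a) = [x_a, x_b]`. [folklore] -/
theorem Dop_apply_left (a b : Fin 3) : Dop (k := k) N a b (xg N a) = xg N a * xg N b - xg N b * xg N a := by
  rw [Dop, sderiv_letter, drule, if_pos rfl]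

/-- `D_{ab}(x_b) = [x_b, x_a]`. [folklore] -/
theorem Dop_apply_right (a b : Fin 3) : Dop (k := k) N a b (xg N b) = xg N b * xg N a - xg N a * xg N b := by
  rw [Dop_comm, Dop_apply_left]

/-- `D_{ab}(x_c) = 0` for `c ∉ {a, b}`. [folklore] -/
theorem Dop_apply_other {a b c : Fin 3} (hca : c ≠ a) (hcb : c ≠ b) : Dop (k := k) N a b (xg N c) = 0 := by
  rw [Dop, sderiv_letter, drule, if_neg hca, if_neg hcb]

/-- The left multiplication `L_c` by the letter `x_c`. [folklore] -/
abbrev Lop (c : Fin 3) : Module.End k (NCSeries (Fin 3) k ⧸ truncIdeal (Fin 3) k N) :=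
  LinearMap.mulLeft k (xg N c)

/-- Strands `0, 2, 3` of `U𝔞₄` ↦ letters `0, 1, 2` (strand `1` is the distinguished one; its
value is unused). [folklore] -/
def strandLetter : Fin 4 → Fin 3 := ![0, 0, 1, 2]

/-- `strandLetter` is injective away from the distinguished strand. [folklore] -/
theorem strandLetter_injective' : ∀ i j : Fin 4, i ≠ 1 → j ≠ 1 →
    strandLetter i = strandLetter j → i = j := by
  decide

/-- `strandLetter` is injective away from the distinguished strand. [folklore] -/
theorem strandLetter_injective {i j : Fin 4} (hi : i ≠ 1) (hj : j ≠ 1)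
    (h : strandLetter i = strandLetter j) : i = j :=
  strandLetter_injective' i j hi hj h

/-- Three distinct non-distinguished strands exhaust the letters. [folklore] -/
theorem strandLetter_cases' : ∀ i j l : Fin 4, i ≠ 1 → j ≠ 1 → l ≠ 1 → i ≠ j → j ≠ l → i ≠ l →
    ∀ c : Fin 3, c = strandLetter i ∨ c = strandLetter j ∨ c = strandLetter l := by
  decide

/-- Three distinct non-distinguished strands exhaust the letters. [folklore] -/
theorem strandLetter_cases {i j l : Fin 4} (hi : i ≠ 1) (hj : j ≠ 1) (hl : l ≠ 1) (hij : i ≠ j)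
    (hjl : j ≠ l) (hil : i ≠ l) (c : Fin 3) :
    c = strandLetter i ∨ c = strandLetter j ∨ c = strandLetter l :=
  strandLetter_cases' i j l hi hj hl hij hjl hil c

/-- Four distinct strands of `U𝔞₄` cannot all avoid the distinguished one. [folklore] -/
theorem no_four_strands_ne_one (i j l m : Fin 4) (hi : i ≠ 1) (hj : j ≠ 1) (hl : l ≠ 1)
    (hm : m ≠ 1) (hij : i ≠ j) (hil : i ≠ l) (him : i ≠ m) (hjl : j ≠ l) (hjm : j ≠ m)
    (hlm : l ≠ m) : False := by
  have := i.isLt; have := j.isLt; have := l.isLt; have := m.isLt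
  simp only [ne_eq, Fin.ext_iff, Fin.val_one] at hi hj hl hm hij hil him hjl hjm hlm
  omega

/-- **The representation on generators** [BarnatanDancso2011, §4]: `t_{1j} ↦ L_{x_j}` (chords
through the distinguished strand act by left multiplication), `t_{ij} ↦ D_{ij}` (the other chords
act by derivations), `t_{ii} ↦ 0`. [cite: BarnatanDancso2011, §4] -/
def repF (i j : Fin 4) : Module.End k (NCSeries (Fin 3) k ⧸ truncIdeal (Fin 3) k N) :=
  if i = j then 0
  else if i = 1 then Lop N (strandLetter j)
  else if j = 1 then Lop N (strandLetter i)
  else Dop N (strandLetter i) (strandLetter j)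

/-- `repF` on a chord through the distinguished strand. [folklore] -/
theorem repF_one_left {j : Fin 4} (hj : j ≠ 1) : repF (k := k) N 1 j = Lop N (strandLetter j) := by
  rw [repF, if_neg (Ne.symm hj), if_pos rfl]

/-- `repF` on a chord through the distinguished strand. [folklore] -/
theorem repF_one_right {i : Fin 4} (hi : i ≠ 1) : repF (k := k) N i 1 = Lop N (strandLetter i) := by
  rw [repF, if_neg hi, if_neg hi, if_pos rfl]

/-- `repF` on a chord avoiding the distinguished strand. [folklore] -/
theorem repF_other {i j : Fin 4} (hij : i ≠ j) (hi : i ≠ 1) (hj : j ≠ 1) :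
    repF (k := k) N i j = Dop N (strandLetter i) (strandLetter j) := by
  rw [repF, if_neg hij, if_neg hi, if_neg hj]

/-- `L_{y + z} = L_y + L_z`. [folklore] -/
theorem mulLeft_add' (y z : NCSeries (Fin 3) k ⧸ truncIdeal (Fin 3) k N) :
    LinearMap.mulLeft k (y + z) = LinearMap.mulLeft k y + LinearMap.mulLeft k z := by
  apply LinearMap.ext; intro x; simp [add_mul]

/-- `L_{-y} = -L_y`. [folklore] -/
theorem mulLeft_neg' (y : NCSeries (Fin 3) k ⧸ truncIdeal (Fin 3) k N) :
    LinearMap.mulLeft k (-y) = -LinearMap.mulLeft k y := by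
  apply LinearMap.ext; intro x; simp

/-- The mixed infinitesimal braid relation `[L_B, L_C + D_{BC}] = 0`. [folklore] -/
theorem Lop_fourTerm {B C : Fin 3} :
    Lop (k := k) N B * (Lop N C + Dop N B C) = (Lop N C + Dop N B C) * Lop N B := by
  have h1 := mulLeft_mul_sub (k := k) N (xg N B) (xg N C)
  have h2 := (isDer_Dop (k := k) N B C).mul_mulLeft_sub N (xg N B)
  rw [Dop_apply_left] at h2
  rw [sub_eq_iff_eq_add] at h1 h2
  -- h1 : L_B L_C = M + L_C L_B ;  h2 : D L_B = M + L_B D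
  rw [mul_add, add_mul, h1, h2]
  abel

/-- The mixed infinitesimal braid relation `[D_{AB}, L_A + L_B] = 0`. [folklore] -/
theorem Dop_fourTerm (A B : Fin 3) :
    Dop (k := k) N A B * (Lop N A + Lop N B) = (Lop N A + Lop N B) * Dop N A B := by
  have h1 := (isDer_Dop (k := k) N A B).mul_mulLeft_sub N (xg N A)
  have h2 := (isDer_Dop (k := k) N A B).mul_mulLeft_sub N (xg N B)
  rw [Dop_apply_left] at h1
  rw [Dop_apply_right] at h2
  have e : xg (k := k) N B * xg N A - xg N A * xg N B = -(xg N A * xg N B - xg N B * xg N A) := by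
    abel
  rw [e, mulLeft_neg'] at h2
  rw [sub_eq_iff_eq_add] at h1 h2
  rw [mul_add, add_mul, h1, h2]
  abel

/-- Locality `[L_A, D_{BC}] = 0` for `A ∉ {B, C}`. [folklore] -/
theorem Lop_Dop_comm {A B C : Fin 3} (hAB : A ≠ B) (hAC : A ≠ C) :
    Lop (k := k) N A * Dop N B C = Dop N B C * Lop N A := by
  have h := (isDer_Dop (k := k) N B C).mul_mulLeft_sub N (xg N A)
  rw [Dop_apply_other N hAB hAC, LinearMap.mulLeft_zero_eq_zero, sub_eq_zero] at h
  exact h.symm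

/-- **The pure infinitesimal braid relation among the derivations**
`[D_{AB}, D_{AC} + D_{BC}] = 0` (the Jacobi identity in disguise), for `{A, B, C} = {0, 1, 2}`.
[folklore] -/
theorem Dop_Dop_fourTerm {A B C : Fin 3} (hAB : A ≠ B) (hBC : B ≠ C) (hAC : A ≠ C)
    (hall : ∀ c : Fin 3, c = A ∨ c = B ∨ c = C) :
    Dop (k := k) N A B * (Dop N A C + Dop N B C) = (Dop N A C + Dop N B C) * Dop N A B := by
  rw [← sub_eq_zero]
  have hder : IsDer N (Dop (k := k) N A B * (Dop N A C + Dop N B C) -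
      (Dop N A C + Dop N B C) * Dop N A B) :=
    (isDer_Dop N A B).commutator N ((isDer_Dop N A C).add N (isDer_Dop N B C))
  refine hder.eq_zero_of_letters N fun c => ?_
  have hA := isDer_Dop (k := k) N A B
  have hAC' := isDer_Dop (k := k) N A C
  have hBC' := isDer_Dop (k := k) N B C
  -- values of the three derivations on the three letters
  have eAB_A := Dop_apply_left (k := k) N A B
  have eAB_B := Dop_apply_right (k := k) N A B
  have eAB_C := Dop_apply_other (k := k) N (Ne.symm hAC) (Ne.symm hBC) (a := A) (b := B)
  have eAC_A := Dop_apply_left (k := k) N A C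
  have eAC_C := Dop_apply_right (k := k) N A C
  have eAC_B := Dop_apply_other (k := k) N (Ne.symm hAB) hBC (a := A) (b := C)
  have eBC_B := Dop_apply_left (k := k) N B C
  have eBC_C := Dop_apply_right (k := k) N B C
  have eBC_A := Dop_apply_other (k := k) N hAB hAC (a := B) (b := C)
  rcases hall c with rfl | rfl | rfl
  · simp only [LinearMap.sub_apply, LinearMap.add_apply, Module.End.mul_apply, eAB_A, eAC_A,
      eBC_A, add_zero, map_sub, hA.leibniz, hAC'.leibniz, hBC'.leibniz, eAB_C, eAC_B, eBC_B]
    noncomm_ring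
  · simp only [LinearMap.sub_apply, LinearMap.add_apply, Module.End.mul_apply, eAB_B, eAC_B,
      eBC_B, zero_add, map_sub, hA.leibniz, hAC'.leibniz, hBC'.leibniz, eAB_C, eAC_A, eBC_A]
    noncomm_ring
  · simp only [LinearMap.sub_apply, LinearMap.add_apply, Module.End.mul_apply, eAB_C, eAC_C,
      eBC_C, map_sub, map_add, map_zero, hA.leibniz, eAB_A, eAB_B]
    noncomm_ring

/-- **The representation respects the relations of `U𝔞₄/(deg > N)`.**
[cite: BarnatanDancso2011, §4] -/
theorem repF_compatible : DrinfeldKohnoTrunc.Compatible N (repF (k := k) N) where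
  diag i := by rw [repF, if_pos rfl]
  symm i j := by
    by_cases hij : i = j
    · subst hij; rfl
    by_cases hi : i = 1
    · subst hi
      rw [repF_one_left N (Ne.symm hij), repF_one_right N (Ne.symm hij)]
    by_cases hj : j = 1
    · subst hj
      rw [repF_one_right N hi, repF_one_left N hi]
    · rw [repF_other N hij hi hj, repF_other N (Ne.symm hij) hj hi, Dop_comm]
  fourTerm i j l hij hjl hil := by
    by_cases hi : i = 1
    · subst hi
      rw [repF_one_left N (Ne.symm hij), repF_one_left N (Ne.symm hil),
        repF_other N hjl (Ne.symm hij) (Ne.symm hil)]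
      exact Lop_fourTerm N
    by_cases hj : j = 1
    · subst hj
      rw [repF_one_right N hi, repF_other N hil hi (Ne.symm hjl), repF_one_left N (Ne.symm hjl),
        add_comm]
      exact Lop_fourTerm N
    by_cases hl : l = 1
    · subst hl
      rw [repF_other N hij hi hj, repF_one_right N hi, repF_one_right N hj]
      exact Dop_fourTerm N _ _
    · rw [repF_other N hij hi hj, repF_other N hil hi hl, repF_other N hjl hj hl]
      exact Dop_Dop_fourTerm N
        (fun h => hij (strandLetter_injective hi hj h))
        (fun h => hjl (strandLetter_injective hj hl h))
        (fun h => hil (strandLetter_injective hi hl h))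
        (strandLetter_cases hi hj hl hij hjl hil)
  locality i j l m hij hil him hjl hjm hlm := by
    by_cases hi : i = 1
    · subst hi
      rw [repF_one_left N (Ne.symm hij), repF_other N hlm (Ne.symm hil) (Ne.symm him)]
      exact Lop_Dop_comm N (fun h => hjl (strandLetter_injective (Ne.symm hij) (Ne.symm hil) h))
        (fun h => hjm (strandLetter_injective (Ne.symm hij) (Ne.symm him) h))
    by_cases hj : j = 1
    · subst hj
      rw [repF_one_right N hi, repF_other N hlm (Ne.symm hjl) (Ne.symm hjm)]
      exact Lop_Dop_comm N (fun h => hil (strandLetter_injective hi (Ne.symm hjl) h))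
        (fun h => him (strandLetter_injective hi (Ne.symm hjm) h))
    by_cases hl : l = 1
    · subst hl
      rw [repF_other N hij hi hj, repF_one_left N (Ne.symm hlm)]
      exact (Lop_Dop_comm N (fun h => him (strandLetter_injective hi (Ne.symm hlm) h.symm))
        (fun h => hjm (strandLetter_injective hj (Ne.symm hlm) h.symm))).symm
    by_cases hm : m = 1
    · subst hm
      rw [repF_other N hij hi hj, repF_one_right N hl]
      exact (Lop_Dop_comm N (fun h => hil (strandLetter_injective hi hl h.symm))
        (fun h => hjl (strandLetter_injective hj hl h.symm))).symm
    · exact (no_four_strands_ne_one i j l m hi hj hl hm hij hil him hjl hjm hlm).elim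
  trunc g := by
    refine list_prod_eq_zero_of_raises N _ (fun T hT => ?_) (by simp)
    rw [List.mem_ofFn] at hT
    obtain ⟨r, rfl⟩ := hT
    unfold repF
    split_ifs
    · intro n x _; rw [LinearMap.zero_apply]; exact Submodule.zero_mem _
    · exact raises_mulLeft N (mk_letter_mem_Fil N _)
    · exact raises_mulLeft N (mk_letter_mem_Fil N _)
    · exact raises_Dop N _ _

variable (k) in
/-- **The representation of `U𝔞₄ ⊗ k/(deg > N)` on `k⟨⟨x₀,x₁,x₂⟩⟩/(deg > N)`** in which the chords
through strand `1` act by left multiplication and the other chords by derivations.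
[cite: BarnatanDancso2011, §4] -/
def rep : DrinfeldKohnoTrunc k (Fin 4) N →ₐ[k]
    Module.End k (NCSeries (Fin 3) k ⧸ truncIdeal (Fin 3) k N) :=
  (repF_compatible (k := k) N).lift

/-- `rep (t i j) = repF i j`. [folklore] -/
@[simp] theorem rep_t (i j : Fin 4) : rep k N (t₄ k N i j) = repF N i j :=
  (repF_compatible (k := k) N).lift_t i j

/-- The letters' strands: letters `0, 1, 2` ↦ strands `0, 2, 3`. [folklore] -/
def letterStrand : Fin 3 → Fin 4 := ![0, 2, 3]

/-- `strandLetter ∘ letterStrand = id`. [folklore] -/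
theorem strandLetter_letterStrand' : ∀ c : Fin 3, strandLetter (letterStrand c) = c := by decide

/-- `strandLetter ∘ letterStrand = id`. [folklore] -/
@[simp] theorem strandLetter_letterStrand (c : Fin 3) : strandLetter (letterStrand c) = c :=
  strandLetter_letterStrand' c

/-- `letterStrand c ≠ 1`. [folklore] -/
theorem letterStrand_ne_one' : ∀ c : Fin 3, letterStrand c ≠ 1 := by decide

/-- `letterStrand c ≠ 1`. [folklore] -/
theorem letterStrand_ne_one (c : Fin 3) : letterStrand c ≠ 1 := letterStrand_ne_one' c

/-- The chord through strand `1` attached to the letter `c`: `ℓ_c = t_{1, letterStrand c}`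
(`ℓ₀ = t₁₀, ℓ₁ = t₁₂, ℓ₂ = t₁₃`). [folklore] -/
abbrev ell (c : Fin 3) : DrinfeldKohnoTrunc k (Fin 4) N := t₄ k N 1 (letterStrand c)

/-- `rep (ℓ_c) = L_{x_c}`. [folklore] -/
theorem rep_ell (c : Fin 3) : rep k N (ell N c) = Lop N c := by
  rw [ell, rep_t, repF_one_left N (letterStrand_ne_one c), strandLetter_letterStrand]

/-- Linear combinations of the `ℓ_c`. [folklore] -/
def lin (a : Fin 3 → k) : DrinfeldKohnoTrunc k (Fin 4) N := ∑ c, a c • ell N c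

/-- The corresponding linear combinations of letters. [folklore] -/
def linV (a : Fin 3 → k) : NCSeries (Fin 3) k ⧸ truncIdeal (Fin 3) k N := ∑ c, a c • xg N c

/-- `rep` of a linear combination of the `ℓ_c` is left multiplication by the corresponding
combination of letters. [folklore] -/
theorem rep_lin (a : Fin 3 → k) : rep k N (lin N a) = LinearMap.mulLeft k (linV N a) := by
  apply LinearMap.ext
  intro z
  simp only [lin, linV, map_sum, map_smul, rep_ell, LinearMap.coe_sum, Finset.sum_apply,
    LinearMap.smul_apply, LinearMap.mulLeft_apply, Finset.sum_mul, smul_mul_assoc]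

/-- `rep` of a word in two such combinations. [folklore] -/
theorem rep_prod_map_bsub (a b : Fin 3 → k) (w : List Bool) :
    rep k N ((w.map (bsub (lin N a) (lin N b))).prod) =
      LinearMap.mulLeft k ((w.map (bsub (linV N a) (linV N b))).prod) := by
  induction w with
  | nil => simp [LinearMap.mulLeft_one]; rfl
  | cons c w ih =>
    rw [List.map_cons, List.prod_cons, map_mul, ih, List.map_cons, List.prod_cons,
      LinearMap.mulLeft_mul]
    congr 1
    cases c
    · exact rep_lin N a
    · exact rep_lin N b

/-- **The retraction formula**: for `a, b` in the span of the chords through strand `1`,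
`rep(ψ(a, b))(1) = ψ(ā, b̄)` in the truncated free algebra on three letters — the left inverse
of `𝔉₃ → 𝒜₄` on evaluations [BarnatanDancso2011, §4, "⟨t₁₂,t₂₃,t₂₄⟩ ≅ 𝔉₃ ⊆ 𝒜₄"].
[cite: BarnatanDancso2011, §4] -/
theorem rep_evalTrunc_one (a b : Fin 3 → k) (ψ : NCSeries Bool k) :
    rep k N (evalTrunc N (bsub (lin N a) (lin N b)) ψ) 1 =
      evalTrunc N (bsub (linV N a) (linV N b)) ψ := by
  rw [evalTrunc_eq_sum_wordsLE, evalTrunc_eq_sum_wordsLE, map_sum, LinearMap.sum_apply]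
  refine Finset.sum_congr rfl fun w _ => ?_
  rw [map_smul, LinearMap.smul_apply, rep_prod_map_bsub, LinearMap.mulLeft_apply, mul_one]

end Rep

end NCSeries

end Literature.NumberTheory.Transcendental
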